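import Summits.CriticalPhenomena.PercolationContinuityZ3.Theorems.PercNearOneGluingNoHeavyLowerTailFrontierDecRowsKeyCellDict
import Summits.CriticalPhenomena.PercolationContinuityZ3.Theorems.PercNearOneGluingNoHeavyLowerTailFrontierDecRowsPinnedEdgeKeyB0All
import HarnessLib

/-!
# The relaxed KEY form `keyB0 = K + B₀` as a reflected 52-cell polynomial

Support file (prover seat `prim-facecert`, gen 6; `--supports stmt-CriticalPhenomena-4575`).  No named facts, no sorries, no `native_decide`; one reflected
expression `keyB0Expr` (bookkeeping, like `keyExpr` / `e3Expr` of `…KeyCellDict`).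
This is the certificate-independent target of a facecert `KB0` certificate replay (FINDING-gen5 §6 recipe with `keyExpr` replaced by `keyB0Expr`):
`keyB0Expr L P₁ P₂ P₃ = keyExpr L P₁ P₂ P₃ + e3Expr P₁ P₂ P₃` and, at the cell valuation of `μ⁰ = μ_{w[e↦0]}` on the five points `Fin.snoc x u`,
`evalE (cellVal μ⁰ (Fin.snoc x u)) (keyB0Expr (liftPat i₀ 4) (ext4 Φ₁) (ext4 Φ₂) (ext4 Φ₃)) = keyB0 μ⁰ μ¹ (pev Φ₁ x) (pev Φ₂ x) (pev Φ₃ x)`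
(`evalE_keyB0Expr_snoc`).  A kernel-checked identity `keyB0Expr · σ = Σ λ·(row × monomial) + …` with nonnegative rows therefore yields `KeyB0HypAtAll`
(`…PinnedEdgeKeyB0All`) and the row for every finite weighted graph.
-/

noncomputable section

namespace Summit.CriticalPhenomena.PercolationContinuityZ3.Theorems

namespace TerminalEdgeInduction

open MeasureTheory Literature.Probability.Percolation Literature.Probability.LatticeModels
open PatternCells FaceCertKernelN
open Lean.Grind.CommRing (Expr)
open scoped Classical BigOperators

variable {n : ℕ}

/-- **Reflected `keyB0` form** of a three-event pattern row at a (terminal, unmarked) pair: `keyExpr + e3Expr` (the latter homogenised with `σ = var 52`,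
which the cell valuation sends to `1`). [this work] -/
def keyB0Expr (L : ((Fin 5 → Fin 5 → Bool) → Bool) → ((Fin 5 → Fin 5 → Bool) → Bool)) (P₁ P₂ P₃ : (Fin 5 → Fin 5 → Bool) → Bool) : Expr :=
  .add (keyExpr L P₁ P₂ P₃) (e3Expr P₁ P₂ P₃)

/-- **The reflected `keyB0` form evaluates to `keyB0 μ⁰ μ¹`** at the cell valuation of `μ⁰` on the five points `Fin.snoc x u`. [this work] -/
theorem evalE_keyB0Expr_snoc (w : Sym2 (Fin n) → unitInterval) (x : Fin 4 → Fin n) (u : Fin n) (i₀ : Fin 4)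
    (Φ₁ Φ₂ Φ₃ : (Fin 4 → Fin 4 → Bool) → Bool) :
    evalE (cellVal (prodBernoulli (Function.update w s(x i₀, u) 0)) (Fin.snoc x u))
        (keyB0Expr (liftPat (Fin.castSucc i₀) (Fin.last 4)) (ext4 Φ₁) (ext4 Φ₂) (ext4 Φ₃)) =
      keyB0 (prodBernoulli (Function.update w s(x i₀, u) 0)) (prodBernoulli (Function.update w s(x i₀, u) 1))
        (pev Φ₁ x) (pev Φ₂ x) (pev Φ₃ x) := by
  rw [keyB0Expr, keyB0]
  simp only [evalE]
  rw [evalE_keyExpr_snoc, evalE_e3Expr, pev_ext4_snoc, pev_ext4_snoc, pev_ext4_snoc]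

/-- **From a nonnegative reflected `keyB0` form to `keyB0 ≥ 0`** (the form in which a kernel-checked certificate is consumed). [this work] -/
theorem keyB0_nonneg_of_evalE (w : Sym2 (Fin n) → unitInterval) (x : Fin 4 → Fin n) (u : Fin n) (i₀ : Fin 4)
    (Φ₁ Φ₂ Φ₃ : (Fin 4 → Fin 4 → Bool) → Bool)
    (h : 0 ≤ evalE (cellVal (prodBernoulli (Function.update w s(x i₀, u) 0)) (Fin.snoc x u))
        (keyB0Expr (liftPat (Fin.castSucc i₀) (Fin.last 4)) (ext4 Φ₁) (ext4 Φ₂) (ext4 Φ₃))) :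
    0 ≤ keyB0 (prodBernoulli (Function.update w s(x i₀, u) 0)) (prodBernoulli (Function.update w s(x i₀, u) 1))
        (pev Φ₁ x) (pev Φ₂ x) (pev Φ₃ x) := by
  rwa [evalE_keyB0Expr_snoc] at h

end TerminalEdgeInduction

end Summit.CriticalPhenomena.PercolationContinuityZ3.Theorems
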